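import Summits.QuantumFields.YangMills.Theorems.BalabanUVNodesN15BumpLattice
import HarnessLib

/-!
# THE SMOOTH CUT-OFF WITH A PLATEAU, III: the TWO-GRID FIT OF THE BUMP's DIFFERENCE QUOTIENTS — `|∇′^±χ̃′_k(x′) − (∇^±χ̃_k)(πx′)| ≤ |κ|·s·(32π⁴ + π²|J|)` between a fine
# sampling (`ξ′`, step `s′`, weight `n′`) and a coarse one (`ξ`, step `s = Ls′`, weight `n`, `ns = n′s′ = κ`) whose coordinates differ by `i_νs′ (mod K)`, `0 ≤ i_ν ≤ L` — file 45's
# `hfit₂`∕`hfit₂b` letter `oχ₂` (FILE 64's template run on FILE I's second-difference letter `16π⁴s²`) (dag-n15-w4 g3, width seat on N15 = NE2; dag-n15-w3 g4's located item (r2))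

Cell `pub-ymgap`, seat `pub-ymgap-dag-n15-w4` (director №399 (3a) width; HUMAN RULING D-0062), generation 3.  `bears_on: R4∕N15 · K3⁸ SpineGivenEndpointR13SepCoPHV
(stmt-QuantumFields-27366)`.  Filed `--supports stmt-QuantumFields-27366 --as helper` — COUNT-NEUTRAL.  Theorems only (0 `def`, 0 `sorry`).  Imports BY NAME this seat's FILE II
`…N15BumpLattice` (`bcube`, `bcube_shift(_symm)`, `bprod_shift_eq(')`, `bcube_eq_mul`, `bprod_erase_mem`) and FILE I `…N15BumpProfile` (`bumpPer`, `bumpPer_add_int_mul`,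
`abs_bumpPer_sub_le`, `abs_bumpPer_second_diff_le`, `bumpPer_nonneg`, `bumpPer_le_one`); dag-n15-c FILE 61 `abs_prod_sub_prod_le`; g8 `fgrad`∕`bgrad`.  Nothing in the tree is modified.

WHY.  File 45 `hasMaj_idef_glueInv_smoothCutDressed` (the two-grid η-defect of the glued live-background propagator) displays, next to the value fits `hfitχ`∕`hfit₁`∕`hfit₁b` (FILE II
`abs_bcube_sub_bcube_le`), the fits of the bump's DIFFERENCE QUOTIENTS across the block map: `hfit₂ : |∇′_μχ̃′_k(p′) − (∇_μχ̃_k)(πp′)| ≤ oχ₂` and `hfit₂b` (backward).  For the sampled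
bump `χ̃_k = Π_ν B_{K,R}(ξ_ν − k_ν)` this is FILE 64's telescoping argument VERBATIM with FILE 60's second-difference letter `32π²s²` replaced by FILE I's `16π⁴s²` (hence `K ≥ 2R + 4`,
`R ≥ 0` in place of `K ≥ 2`): §1 one coordinate — ★ `abs_diff_bumpPer_shift_le` (drift of the one-step difference, `p·16π⁴s′²`), `bumpPer_telescope`, ★★ `abs_dq_bumpPer_sub_le` and its
backward twin ★★ `abs_bdq_bumpPer_sub_le` (`≤ 32π⁴|κ|s`); §2 the product carriers — ★★★ `abs_fgrad_bcube_two_grid_le` ∕ ★★★ `abs_bgrad_bcube_two_grid_le` under FILE 64's hypotheses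
`hξ hξ′ hoff` (`oχ₂ = |κ|·s·(32π⁴ + π²|J|)`; on King's torus pair with `s = 1∕m`, `κ = n∕m`: `oχ₂ = (|n|∕m)(1∕m)(32π⁴ + π²|J|)` — FILE IV); §3 (v1.1, append-only) the SHIFTED value
fits `hfit₁`∕`hfit₁b` explicitly — ★★ `abs_bcube_shift_sub_bcube_shift_le` (`≤ π|J|s`) ∕ `abs_bcube_shift_symm_sub_bcube_shift_symm_le` (`≤ 2π|J|s`): one fine bond against one coarse bond.

HONEST FRAMING ∕ LIMITS.  Elementary telescoping; [B9] Thm 3.14 pp.426–427 (the two-grid difference template) and (3.62)–(3.65) pp.402–403 are SHAPES only — nothing of [B5]∕[B6]∕[B9]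
asserted; the coordinate data `hξ hξ′ hoff` are the consumer's torus data (inhabited on King's torus pair in FILE IV ∕ dag-n15-w4 g0 file C).  NE2⁺ NOT PRINTED, NOT proved; N15 NOT
discharged; counts of record UNMOVED (typed 28∕28 · discharged 5∕27); one finite 𝕋⁴ at fixed ε — NOT infinite volume, NOT OS on ℝ⁴, NOT a mass gap, NOT Clay; R4 closes the
conditional finite-𝕋⁴ rung `BalabanLadder.UV` only.  Restate-immune (no Theses import).
-/

noncomputable section

namespace Summit.QuantumFields.YangMills.BalabanUVNodes.N15.Gluing

open Real
open Summit.QuantumFields.YangMills.BalabanUVNodes.N15.BackgroundLayer (fgrad bgrad fgrad_apply bgrad_apply)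

/-! ## §1 One coordinate: drift of the one-step difference, telescope, the difference-quotient fits -/

section OneDim

variable {K : ℕ} {R : ℝ}

/-- ★ **DRIFT OF THE ONE-STEP DIFFERENCE of the bump**: `D(w) := B_{K,R}(w + s′) − B_{K,R}(w)` moves by at most `16π⁴s′²` per step: `|D(v + ps′) − D(v)| ≤ p·16π⁴s′²` (`0 ≤ s′ ≤ 1`,
`R ≥ 0`, `K ≥ 2R + 4`; FILE I `abs_bumpPer_second_diff_le`). [folklore] -/
theorem abs_diff_bumpPer_shift_le (hK0 : 0 < K) (hR : 0 ≤ R) (hRK : 2 * R + 4 ≤ K) {s' : ℝ} (hs : 0 ≤ s') (hs1 : s' ≤ 1) (v : ℝ) (p : ℕ) :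
    |(bumpPer K R (v + p * s' + s') - bumpPer K R (v + p * s')) - (bumpPer K R (v + s') - bumpPer K R v)| ≤ p * (16 * π ^ 4 * s' ^ 2) := by
  induction p with
  | zero => simp
  | succ p ih =>
      have step := abs_bumpPer_second_diff_le hK0 hR hRK (u := v + p * s' + s') hs hs1
      rw [show v + p * s' + s' - s' = v + p * s' by ring] at step
      push_cast
      calc |bumpPer K R (v + (p + 1) * s' + s') - bumpPer K R (v + (p + 1) * s') - (bumpPer K R (v + s') - bumpPer K R v)|
          = |(bumpPer K R (v + p * s' + s' + s') - 2 * bumpPer K R (v + p * s' + s') + bumpPer K R (v + p * s')) +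
              ((bumpPer K R (v + p * s' + s') - bumpPer K R (v + p * s')) - (bumpPer K R (v + s') - bumpPer K R v))| := by ring_nf
        _ ≤ 16 * π ^ 4 * s' ^ 2 + p * (16 * π ^ 4 * s' ^ 2) := (abs_add_le _ _).trans (add_le_add step ih)
        _ = (p + 1) * (16 * π ^ 4 * s' ^ 2) := by ring

/-- ★ **TELESCOPE**: `B_{K,R}(u + Ls′) − B_{K,R}(u) = Σ_{j<L} [B_{K,R}(u + js′ + s′) − B_{K,R}(u + js′)]`. [folklore] -/
theorem bumpPer_telescope (u s' : ℝ) (L : ℕ) : bumpPer K R (u + L * s') - bumpPer K R u = ∑ j ∈ Finset.range L, (bumpPer K R (u + j * s' + s') - bumpPer K R (u + j * s')) := by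
  induction L with
  | zero => simp
  | succ L ih =>
      rw [Finset.sum_range_succ, ← ih]
      push_cast
      ring_nf

/-- ★★ **THE DIFFERENCE-QUOTIENT FIT of the bump** (twin of FILE 64 `abs_dq_thetaPer_sub_le`): `s = Ls′`, `ns = n′s′ = κ`, `u′ = u + is′ + zK` with `0 ≤ i ≤ L`, `0 ≤ s′ ≤ 1`,
`R ≥ 0`, `K ≥ 2R + 4` ⟹ `|n′(B_{K,R}(u′ + s′) − B_{K,R}(u′)) − n(B_{K,R}(u + s) − B_{K,R}(u))| ≤ 32π⁴·|κ|·s`. [cite: Balaban1985BackgroundPropagators, Thm 3.14 pp.426–427 (difference template: shape)] -/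
theorem abs_dq_bumpPer_sub_le (hK0 : 0 < K) (hR : 0 ≤ R) (hRK : 2 * R + 4 ≤ K) {s s' κ n n' u u' : ℝ} {L : ℕ} {i : ℕ} {z : ℤ} (hL : 1 ≤ L) (hs : 0 ≤ s') (hs1 : s' ≤ 1) (hsL : s = L * s') (hn : n * s = κ) (hn' : n' * s' = κ)
    (hi : i ≤ L) (hu' : u' = u + i * s' + z * K) :
    |n' * (bumpPer K R (u' + s') - bumpPer K R u') - n * (bumpPer K R (u + s) - bumpPer K R u)| ≤ 32 * π ^ 4 * |κ| * s := by
  have hLr : (1 : ℝ) ≤ L := by exact_mod_cast hL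
  have hLpos : (0 : ℝ) < L := by linarith
  -- remove the period
  have e1 : bumpPer K R (u' + s') = bumpPer K R (u + i * s' + s') := by
    rw [hu', show u + i * s' + z * K + s' = (u + i * s' + s') + z * K by ring, bumpPer_add_int_mul hK0 R]
  have e2 : bumpPer K R u' = bumpPer K R (u + i * s') := by rw [hu', bumpPer_add_int_mul hK0 R]
  rw [e1, e2, hsL, bumpPer_telescope]
  -- n = κ/(L s'), n' = κ/s' (when s' ≠ 0); the degenerate s' = 0 case is trivial
  rcases eq_or_lt_of_le hs with hs0 | hs0
  · rw [← hs0]; simp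
  have hn_eq : n = κ / (L * s') := by rw [← hn, hsL]; field_simp
  have hn'_eq : n' = κ / s' := by rw [← hn']; field_simp
  obtain ⟨D, hD⟩ : ∃ D : ℕ → ℝ, ∀ j : ℕ, bumpPer K R (u + j * s' + s') - bumpPer K R (u + j * s') = D j := ⟨_, fun _ => rfl⟩
  have hC : 0 ≤ 16 * π ^ 4 * s' ^ 2 := by positivity
  have hdrift : ∀ j : ℕ, j < L → |D i - D j| ≤ 2 * L * (16 * π ^ 4 * s' ^ 2) := by
    intro j hj
    have a := abs_diff_bumpPer_shift_le hK0 hR hRK hs0.le hs1 u j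
    have b := abs_diff_bumpPer_shift_le hK0 hR hRK hs0.le hs1 u i
    rw [hD j] at a
    rw [hD i] at b
    have hj' : (j : ℝ) ≤ L := by exact_mod_cast hj.le
    have hi' : (i : ℝ) ≤ L := by exact_mod_cast hi
    calc |D i - D j| ≤ |D i - (bumpPer K R (u + s') - bumpPer K R u)| + |(bumpPer K R (u + s') - bumpPer K R u) - D j| := abs_sub_le _ _ _
      _ ≤ i * (16 * π ^ 4 * s' ^ 2) + j * (16 * π ^ 4 * s' ^ 2) := add_le_add b (by rw [abs_sub_comm]; exact a)
      _ ≤ 2 * L * (16 * π ^ 4 * s' ^ 2) := by nlinarith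
  simp only [hD]
  have key : n' * D i - n * ∑ j ∈ Finset.range L, D j = (κ / (L * s')) * ∑ j ∈ Finset.range L, (D i - D j) := by
    rw [hn_eq, hn'_eq, Finset.sum_sub_distrib, Finset.sum_const, Finset.card_range, nsmul_eq_mul]
    field_simp
  have hsum : |∑ j ∈ Finset.range L, (D i - D j)| ≤ L * (2 * L * (16 * π ^ 4 * s' ^ 2)) := by
    refine (Finset.abs_sum_le_sum_abs _ _).trans ?_
    calc ∑ j ∈ Finset.range L, |D i - D j| ≤ ∑ j ∈ Finset.range L, 2 * L * (16 * π ^ 4 * s' ^ 2) :=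
          Finset.sum_le_sum fun j hj => hdrift j (Finset.mem_range.1 hj)
      _ = L * (2 * L * (16 * π ^ 4 * s' ^ 2)) := by rw [Finset.sum_const, Finset.card_range, nsmul_eq_mul]
  rw [key, abs_mul, abs_div, abs_mul, abs_of_pos hLpos, abs_of_pos hs0]
  calc |κ| / (L * s') * |∑ j ∈ Finset.range L, (D i - D j)| ≤ |κ| / (L * s') * (L * (2 * L * (16 * π ^ 4 * s' ^ 2))) :=
        mul_le_mul_of_nonneg_left hsum (by positivity)
    _ = 32 * π ^ 4 * |κ| * (L * s') := by field_simp; ring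



/-- ★★ **THE BACKWARD DIFFERENCE-QUOTIENT FIT of the bump** (twin of dag-n15-w4 g0's `abs_bdq_thetaPer_sub_le`): same data ⟹
`|n′(B_{K,R}(u′) − B_{K,R}(u′ − s′)) − n(B_{K,R}(u) − B_{K,R}(u − s))| ≤ 32π⁴·|κ|·s` (the fine pair sits `L + i − 1 ∈ [L − 1, 2L)` fine steps above the coarse backward foot).
[cite: Balaban1985BackgroundPropagators, Thm 3.14 pp.426–427 (difference template: shape)] -/
theorem abs_bdq_bumpPer_sub_le (hK0 : 0 < K) (hR : 0 ≤ R) (hRK : 2 * R + 4 ≤ K) {s s' κ n n' u u' : ℝ} {L : ℕ} {i : ℕ} {z : ℤ} (hL : 1 ≤ L) (hs : 0 ≤ s') (hs1 : s' ≤ 1) (hsL : s = L * s') (hn : n * s = κ)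
    (hn' : n' * s' = κ) (hi : i ≤ L) (hu' : u' = u + i * s' + z * K) :
    |n' * (bumpPer K R u' - bumpPer K R (u' - s')) - n * (bumpPer K R u - bumpPer K R (u - s))| ≤ 32 * π ^ 4 * |κ| * s := by
  have hLr : (1 : ℝ) ≤ L := by exact_mod_cast hL
  have hLpos : (0 : ℝ) < L := by linarith
  -- the coarse backward foot v = u − s = u − Ls′
  obtain ⟨v, hv⟩ : ∃ v : ℝ, u = v + L * s' := ⟨u - L * s', by ring⟩
  have hq1 : 1 ≤ L + i := by omega
  have e1 : bumpPer K R u' = bumpPer K R (v + ((L + i - 1 : ℕ) : ℝ) * s' + s') := by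
    rw [hu', hv, bumpPer_add_int_mul hK0 R, Nat.cast_sub hq1, Nat.cast_add, Nat.cast_one]; ring_nf
  have e2 : bumpPer K R (u' - s') = bumpPer K R (v + ((L + i - 1 : ℕ) : ℝ) * s') := by
    rw [hu', hv, show v + L * s' + i * s' + z * K - s' = (v + L * s' + i * s' - s') + z * K by ring, bumpPer_add_int_mul hK0 R, Nat.cast_sub hq1, Nat.cast_add,
      Nat.cast_one]; ring_nf
  rw [e1, e2, hv, hsL, show v + L * s' - L * s' = v by ring, bumpPer_telescope]
  rcases eq_or_lt_of_le hs with hs0 | hs0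
  · rw [← hs0]; simp
  have hn_eq : n = κ / (L * s') := by rw [← hn, hsL]; field_simp
  have hn'_eq : n' = κ / s' := by rw [← hn']; field_simp
  obtain ⟨D, hD⟩ : ∃ D : ℕ → ℝ, ∀ j : ℕ, bumpPer K R (v + j * s' + s') - bumpPer K R (v + j * s') = D j := ⟨_, fun _ => rfl⟩
  obtain ⟨q, hq⟩ : ∃ q : ℕ, q = L + i - 1 := ⟨_, rfl⟩
  rw [← hq]
  have hC : 0 ≤ 16 * π ^ 4 * s' ^ 2 := by positivity
  have hdrift : ∀ j : ℕ, j < L → |D q - D j| ≤ 2 * L * (16 * π ^ 4 * s' ^ 2) := by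
    intro j hj
    have hjq : j ≤ q := by omega
    have h := abs_diff_bumpPer_shift_le hK0 hR hRK hs hs1 (v + j * s') (q - j)
    rw [show v + j * s' + ((q - j : ℕ) : ℝ) * s' = v + q * s' by rw [Nat.cast_sub hjq]; ring, hD, hD] at h
    refine h.trans (mul_le_mul_of_nonneg_right ?_ hC)
    have : (q - j : ℕ) ≤ 2 * L := by omega
    exact_mod_cast this
  simp only [hD]
  have key : n' * D q - n * ∑ j ∈ Finset.range L, D j = (κ / (L * s')) * ∑ j ∈ Finset.range L, (D q - D j) := by
    rw [hn_eq, hn'_eq, Finset.sum_sub_distrib, Finset.sum_const, Finset.card_range, nsmul_eq_mul]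
    field_simp
  have hsum : |∑ j ∈ Finset.range L, (D q - D j)| ≤ L * (2 * L * (16 * π ^ 4 * s' ^ 2)) := by
    refine (Finset.abs_sum_le_sum_abs _ _).trans ?_
    calc ∑ j ∈ Finset.range L, |D q - D j| ≤ ∑ j ∈ Finset.range L, 2 * L * (16 * π ^ 4 * s' ^ 2) :=
          Finset.sum_le_sum fun j hj => hdrift j (Finset.mem_range.1 hj)
      _ = L * (2 * L * (16 * π ^ 4 * s' ^ 2)) := by rw [Finset.sum_const, Finset.card_range, nsmul_eq_mul]
  rw [key, abs_mul, abs_div, abs_mul, abs_of_pos hLpos, abs_of_pos hs0]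
  calc |κ| / (L * s') * |∑ j ∈ Finset.range L, (D q - D j)| ≤ |κ| / (L * s') * (L * (2 * L * (16 * π ^ 4 * s' ^ 2))) :=
        mul_le_mul_of_nonneg_left hsum (by positivity)
    _ = 32 * π ^ 4 * |κ| * (L * s') := by field_simp; ring

end OneDim

/-! ## §2 The product carriers: file 45's `oχ₂` -/

section Lattice

variable {X X' : Type} {J : Type} [Fintype J] [DecidableEq J] (K : ℕ) (ξ : J → X → ℝ) (ξ' : J → X' → ℝ) (R : ℝ) (pr : X' → X) (e : J → X ≃ X) (e' : J → X' ≃ X')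

/-- ★★★ **THE TWO-GRID FIT OF `∇χ̃`** (file 45's `hfit₂` with `oχ₂ = |κ|·s·(32π⁴ + π²|J|)`, `κ = ns = n′s′`): coarse∕fine coordinates with FILE 61's shift compatibilities,
`s = Ls′`, `0 ≤ s′ ≤ 1`, `R ≥ 0`, `K ≥ 2R + 4`, and every fine coordinate offset from its coarse image by `i_ν s′ (mod K)` with `0 ≤ i_ν ≤ L` (FILE 64's `hoff`) ⟹
`|fgrad n′ (e′ μ) (bcube K ξ′ R k) x′ − fgrad n (e μ) (bcube K ξ R k) (πx′)| ≤ |κ|·s·(32π⁴ + π²|J|)`. [cite: Balaban1985BackgroundPropagators, (3.62)–(3.65) pp.402–403 (shape), Thm 3.14 pp.426–427 (difference template)] -/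
theorem abs_fgrad_bcube_two_grid_le (hK0 : 0 < K) (hR : 0 ≤ R) (hRK : 2 * R + 4 ≤ K) {s s' κ n n' : ℝ} {L : ℕ} (hL : 1 ≤ L) (hs : 0 ≤ s') (hs1 : s' ≤ 1) (hsL : s = L * s') (hn : n * s = κ) (hn' : n' * s' = κ)
    (hξ : ∀ μ ν x, ∃ z : ℤ, ξ ν (e μ x) = ξ ν x + (if ν = μ then s else 0) + z * K) (hξ' : ∀ μ ν x', ∃ z : ℤ, ξ' ν (e' μ x') = ξ' ν x' + (if ν = μ then s' else 0) + z * K)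
    (hoff : ∀ ν x', ∃ i : ℕ, i ≤ L ∧ ∃ z : ℤ, ξ' ν x' = ξ ν (pr x') + i * s' + z * K) (k : J → ZMod K) (μ : J) (x' : X') :
    |fgrad n' (e' μ) (bcube K ξ' R k) x' - fgrad n (e μ) (bcube K ξ R k) (pr x')| ≤ |κ| * s * (32 * π ^ 4 + π ^ 2 * Fintype.card J) := by
  have hsnn : 0 ≤ s := by rw [hsL]; positivity
  rw [fgrad_apply, fgrad_apply, bcube_shift K ξ' R e' hK0 hξ', bprod_shift_eq, bcube_eq_mul K ξ' R k μ x', bcube_shift K ξ R e hK0 hξ, bprod_shift_eq, bcube_eq_mul K ξ R k μ (pr x')]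
  have regroup : ∀ n₁ n₂ A₁ B₁ A₂ B₂ P₁ P₂ : ℝ, n₁ * (A₁ * P₁ - B₁ * P₁) - n₂ * (A₂ * P₂ - B₂ * P₂) = (n₁ * (A₁ - B₁) - n₂ * (A₂ - B₂)) * P₁ + n₂ * (A₂ - B₂) * (P₁ - P₂) := by
    intros; ring
  rw [regroup]
  -- the two complementary products
  have hP' := bprod_erase_mem K ξ' R k μ x'
  have hP := bprod_erase_mem K ξ R k μ (pr x')
  -- first term: the one-coordinate difference-quotient fit
  obtain ⟨i, hi, z, hz⟩ := hoff μ x'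
  have hu' : ξ' μ x' - ((k μ).val : ℝ) = (ξ μ (pr x') - ((k μ).val : ℝ)) + i * s' + z * K := by rw [hz]; ring
  have t1 := abs_dq_bumpPer_sub_le hK0 hR hRK hL hs hs1 hsL hn hn' hi hu'
  rw [show ξ μ (pr x') - ((k μ).val : ℝ) + s = ξ μ (pr x') + s - ((k μ).val : ℝ) by ring, show ξ' μ x' - ((k μ).val : ℝ) + s' = ξ' μ x' + s' - ((k μ).val : ℝ) by ring] at t1
  -- second term: the coarse difference times the drift of the other coordinates
  have hΔ : |bumpPer K R (ξ μ (pr x') + s - ((k μ).val : ℝ)) - bumpPer K R (ξ μ (pr x') - ((k μ).val : ℝ))| ≤ π * s := by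
    refine (abs_bumpPer_sub_le hK0 R _ _).trans (le_of_eq ?_)
    rw [show ξ μ (pr x') + s - ((k μ).val : ℝ) - (ξ μ (pr x') - ((k μ).val : ℝ)) = s by ring, abs_of_nonneg hsnn]
  have hPP : |(∏ ν ∈ Finset.univ.erase μ, bumpPer K R (ξ' ν x' - ((k ν).val : ℝ))) - ∏ ν ∈ Finset.univ.erase μ, bumpPer K R (ξ ν (pr x') - ((k ν).val : ℝ))| ≤ Fintype.card J * (π * s) := by
    refine (abs_prod_sub_prod_le (Finset.univ.erase μ) _ _ (fun ν => ⟨bumpPer_nonneg K R _, bumpPer_le_one K R _⟩)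
      (fun ν => ⟨bumpPer_nonneg K R _, bumpPer_le_one K R _⟩)).trans ?_
    have hterm : ∀ ν ∈ Finset.univ.erase μ, |bumpPer K R (ξ' ν x' - ((k ν).val : ℝ)) - bumpPer K R (ξ ν (pr x') - ((k ν).val : ℝ))| ≤ π * s := by
      intro ν _
      obtain ⟨iν, hiν, zν, hzν⟩ := hoff ν x'
      rw [hzν, show ξ ν (pr x') + iν * s' + zν * K - ((k ν).val : ℝ) = (ξ ν (pr x') + iν * s' - ((k ν).val : ℝ)) + zν * K by ring, bumpPer_add_int_mul hK0 R]
      refine (abs_bumpPer_sub_le hK0 R _ _).trans ?_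
      rw [show ξ ν (pr x') + iν * s' - ((k ν).val : ℝ) - (ξ ν (pr x') - ((k ν).val : ℝ)) = iν * s' by ring, abs_of_nonneg (by positivity)]
      have : (iν : ℝ) * s' ≤ L * s' := mul_le_mul_of_nonneg_right (by exact_mod_cast hiν) hs
      rw [hsL]; exact mul_le_mul_of_nonneg_left this Real.pi_pos.le
    calc ∑ ν ∈ Finset.univ.erase μ, |bumpPer K R (ξ' ν x' - ((k ν).val : ℝ)) - bumpPer K R (ξ ν (pr x') - ((k ν).val : ℝ))|
        ≤ ∑ ν ∈ Finset.univ.erase μ, π * s := Finset.sum_le_sum hterm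
      _ = (Finset.univ.erase μ).card * (π * s) := by rw [Finset.sum_const, nsmul_eq_mul]
      _ ≤ Fintype.card J * (π * s) := by
          refine mul_le_mul_of_nonneg_right ?_ (by positivity)
          exact_mod_cast (Finset.card_erase_le).trans (Finset.card_univ (α := J)).le
  have hns : |n| * s = |κ| := by rw [← hn, abs_mul, abs_of_nonneg hsnn]
  refine (abs_add_le _ _).trans ?_
  rw [abs_mul, abs_mul, abs_mul, abs_of_nonneg hP'.1]
  have b1 : |n' * (bumpPer K R (ξ' μ x' + s' - ((k μ).val : ℝ)) - bumpPer K R (ξ' μ x' - ((k μ).val : ℝ))) -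
      n * (bumpPer K R (ξ μ (pr x') + s - ((k μ).val : ℝ)) - bumpPer K R (ξ μ (pr x') - ((k μ).val : ℝ)))| *
      ∏ ν ∈ Finset.univ.erase μ, bumpPer K R (ξ' ν x' - ((k ν).val : ℝ)) ≤ 32 * π ^ 4 * |κ| * s := (mul_le_of_le_one_right (abs_nonneg _) hP'.2).trans t1
  have b2 : |n| * |bumpPer K R (ξ μ (pr x') + s - ((k μ).val : ℝ)) - bumpPer K R (ξ μ (pr x') - ((k μ).val : ℝ))| *
      |(∏ ν ∈ Finset.univ.erase μ, bumpPer K R (ξ' ν x' - ((k ν).val : ℝ))) - ∏ ν ∈ Finset.univ.erase μ, bumpPer K R (ξ ν (pr x') - ((k ν).val : ℝ))| ≤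
      |n| * (π * s) * (Fintype.card J * (π * s)) := mul_le_mul (mul_le_mul_of_nonneg_left hΔ (abs_nonneg _)) hPP (abs_nonneg _) (by positivity)
  calc _ ≤ 32 * π ^ 4 * |κ| * s + |n| * (π * s) * (Fintype.card J * (π * s)) := add_le_add b1 b2
    _ = |κ| * s * (32 * π ^ 4 + π ^ 2 * Fintype.card J) := by rw [← hns]; ring



/-- ★★★ **THE TWO-GRID FIT OF `∇⁻χ̃`** (file 45's `hfit₂b`, same letter `oχ₂ = |κ|·s·(32π⁴ + π²|J|)`): same hypotheses ⟹
`|bgrad n′ (e′ μ) (bcube K ξ′ R k) x′ − bgrad n (e μ) (bcube K ξ R k) (πx′)| ≤ |κ|·s·(32π⁴ + π²|J|)`. [cite: Balaban1985BackgroundPropagators, (3.62)–(3.65) pp.402–403 (shape), Thm 3.14 pp.426–427 (difference template)] -/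
theorem abs_bgrad_bcube_two_grid_le (hK0 : 0 < K) (hR : 0 ≤ R) (hRK : 2 * R + 4 ≤ K) {s s' κ n n' : ℝ} {L : ℕ} (hL : 1 ≤ L) (hs : 0 ≤ s') (hs1 : s' ≤ 1) (hsL : s = L * s') (hn : n * s = κ) (hn' : n' * s' = κ)
    (hξ : ∀ μ ν x, ∃ z : ℤ, ξ ν (e μ x) = ξ ν x + (if ν = μ then s else 0) + z * K) (hξ' : ∀ μ ν x', ∃ z : ℤ, ξ' ν (e' μ x') = ξ' ν x' + (if ν = μ then s' else 0) + z * K)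
    (hoff : ∀ ν x', ∃ i : ℕ, i ≤ L ∧ ∃ z : ℤ, ξ' ν x' = ξ ν (pr x') + i * s' + z * K) (k : J → ZMod K) (μ : J) (x' : X') :
    |bgrad n' (e' μ) (bcube K ξ' R k) x' - bgrad n (e μ) (bcube K ξ R k) (pr x')| ≤ |κ| * s * (32 * π ^ 4 + π ^ 2 * Fintype.card J) := by
  have hsnn : 0 ≤ s := by rw [hsL]; positivity
  rw [bgrad_apply, bgrad_apply, bcube_shift_symm K ξ' R e' hK0 hξ', bprod_shift_eq', bcube_eq_mul K ξ' R k μ x', bcube_shift_symm K ξ R e hK0 hξ, bprod_shift_eq',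
    bcube_eq_mul K ξ R k μ (pr x')]
  have regroup : ∀ n₁ n₂ A₁ B₁ A₂ B₂ P₁ P₂ : ℝ, n₁ * (A₁ * P₁ - B₁ * P₁) - n₂ * (A₂ * P₂ - B₂ * P₂) = (n₁ * (A₁ - B₁) - n₂ * (A₂ - B₂)) * P₁ + n₂ * (A₂ - B₂) * (P₁ - P₂) := by
    intros; ring
  rw [regroup]
  have hP' := bprod_erase_mem K ξ' R k μ x'
  obtain ⟨i, hi, z, hz⟩ := hoff μ x'
  have hu' : ξ' μ x' - ((k μ).val : ℝ) = (ξ μ (pr x') - ((k μ).val : ℝ)) + i * s' + z * K := by rw [hz]; ring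
  have t1 := abs_bdq_bumpPer_sub_le hK0 hR hRK hL hs hs1 hsL hn hn' hi hu'
  rw [show ξ μ (pr x') - ((k μ).val : ℝ) - s = ξ μ (pr x') - s - ((k μ).val : ℝ) by ring, show ξ' μ x' - ((k μ).val : ℝ) - s' = ξ' μ x' - s' - ((k μ).val : ℝ) by ring] at t1
  have hΔ : |bumpPer K R (ξ μ (pr x') - ((k μ).val : ℝ)) - bumpPer K R (ξ μ (pr x') - s - ((k μ).val : ℝ))| ≤ π * s := by
    refine (abs_bumpPer_sub_le hK0 R _ _).trans (le_of_eq ?_)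
    rw [show ξ μ (pr x') - ((k μ).val : ℝ) - (ξ μ (pr x') - s - ((k μ).val : ℝ)) = s by ring, abs_of_nonneg hsnn]
  have hPP : |(∏ ν ∈ Finset.univ.erase μ, bumpPer K R (ξ' ν x' - ((k ν).val : ℝ))) - ∏ ν ∈ Finset.univ.erase μ, bumpPer K R (ξ ν (pr x') - ((k ν).val : ℝ))|
      ≤ Fintype.card J * (π * s) := by
    refine (abs_prod_sub_prod_le (Finset.univ.erase μ) _ _ (fun ν => ⟨bumpPer_nonneg K R _, bumpPer_le_one K R _⟩)
      (fun ν => ⟨bumpPer_nonneg K R _, bumpPer_le_one K R _⟩)).trans ?_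
    have hterm : ∀ ν ∈ Finset.univ.erase μ, |bumpPer K R (ξ' ν x' - ((k ν).val : ℝ)) - bumpPer K R (ξ ν (pr x') - ((k ν).val : ℝ))| ≤ π * s := by
      intro ν _
      obtain ⟨iν, hiν, zν, hzν⟩ := hoff ν x'
      rw [hzν, show ξ ν (pr x') + iν * s' + zν * K - ((k ν).val : ℝ) = (ξ ν (pr x') + iν * s' - ((k ν).val : ℝ)) + zν * K by ring, bumpPer_add_int_mul hK0 R]
      refine (abs_bumpPer_sub_le hK0 R _ _).trans ?_
      rw [show ξ ν (pr x') + iν * s' - ((k ν).val : ℝ) - (ξ ν (pr x') - ((k ν).val : ℝ)) = iν * s' by ring, abs_of_nonneg (by positivity)]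
      have : (iν : ℝ) * s' ≤ L * s' := mul_le_mul_of_nonneg_right (by exact_mod_cast hiν) hs
      rw [hsL]; exact mul_le_mul_of_nonneg_left this Real.pi_pos.le
    calc ∑ ν ∈ Finset.univ.erase μ, |bumpPer K R (ξ' ν x' - ((k ν).val : ℝ)) - bumpPer K R (ξ ν (pr x') - ((k ν).val : ℝ))|
        ≤ ∑ ν ∈ Finset.univ.erase μ, π * s := Finset.sum_le_sum hterm
      _ = (Finset.univ.erase μ).card * (π * s) := by rw [Finset.sum_const, nsmul_eq_mul]
      _ ≤ Fintype.card J * (π * s) := by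
          refine mul_le_mul_of_nonneg_right ?_ (by positivity)
          exact_mod_cast (Finset.card_erase_le).trans (Finset.card_univ (α := J)).le
  have hns : |n| * s = |κ| := by rw [← hn, abs_mul, abs_of_nonneg hsnn]
  refine (abs_add_le _ _).trans ?_
  rw [abs_mul, abs_mul, abs_mul, abs_of_nonneg hP'.1]
  have b1 : |n' * (bumpPer K R (ξ' μ x' - ((k μ).val : ℝ)) - bumpPer K R (ξ' μ x' - s' - ((k μ).val : ℝ))) -
      n * (bumpPer K R (ξ μ (pr x') - ((k μ).val : ℝ)) - bumpPer K R (ξ μ (pr x') - s - ((k μ).val : ℝ)))| *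
      ∏ ν ∈ Finset.univ.erase μ, bumpPer K R (ξ' ν x' - ((k ν).val : ℝ)) ≤ 32 * π ^ 4 * |κ| * s := (mul_le_of_le_one_right (abs_nonneg _) hP'.2).trans t1
  have b2 : |n| * |bumpPer K R (ξ μ (pr x') - ((k μ).val : ℝ)) - bumpPer K R (ξ μ (pr x') - s - ((k μ).val : ℝ))| *
      |(∏ ν ∈ Finset.univ.erase μ, bumpPer K R (ξ' ν x' - ((k ν).val : ℝ))) - ∏ ν ∈ Finset.univ.erase μ, bumpPer K R (ξ ν (pr x') - ((k ν).val : ℝ))| ≤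
      |n| * (π * s) * (Fintype.card J * (π * s)) := mul_le_mul (mul_le_mul_of_nonneg_left hΔ (abs_nonneg _)) hPP (abs_nonneg _) (by positivity)
  calc _ ≤ 32 * π ^ 4 * |κ| * s + |n| * (π * s) * (Fintype.card J * (π * s)) := add_le_add b1 b2
    _ = |κ| * s * (32 * π ^ 4 + π ^ 2 * Fintype.card J) := by rw [← hns]; ring

end Lattice

/-! ## §3 (v1.1) The SHIFTED value fits `hfit₁`∕`hfit₁b`: one fine bond against one coarse bond -/

section ShiftFit

variable {X X' : Type} {J : Type} [Fintype J] [DecidableEq J] (K : ℕ) (ξ : J → X → ℝ) (ξ' : J → X' → ℝ) (R : ℝ) (pr : X' → X) (e : J → X ≃ X) (e' : J → X' ≃ X')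

omit [Fintype J] in
/-- One coordinate, forward: the fine shifted point and the coarse shifted image differ by `(i_ν + δ_{νμ}(1 − L))s′ (mod K)`, `0 ≤ i_ν ≤ L`, so the circle distance is `≤ Ls′ = s`
(`L ≥ 1`). [cite: Balaban1985BackgroundPropagators, Thm 3.14 pp.426–427 (difference template: shape)] -/
theorem abs_cenRep_shift_pair_le (hK0 : 0 < K) {s s' : ℝ} {L : ℕ} (hL : 1 ≤ L) (hs : 0 ≤ s') (hsL : s = L * s')
    (hξ : ∀ μ ν x, ∃ z : ℤ, ξ ν (e μ x) = ξ ν x + (if ν = μ then s else 0) + z * K) (hξ' : ∀ μ ν x', ∃ z : ℤ, ξ' ν (e' μ x') = ξ' ν x' + (if ν = μ then s' else 0) + z * K)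
    (hoff : ∀ ν x', ∃ i : ℕ, i ≤ L ∧ ∃ z : ℤ, ξ' ν x' = ξ ν (pr x') + i * s' + z * K) (μ ν : J) (x' : X') :
    |cenRep K (ξ' ν (e' μ x') - ξ ν (e μ (pr x')))| ≤ s := by
  obtain ⟨z₁, h₁⟩ := hξ' μ ν x'
  obtain ⟨i, hi, z₂, h₂⟩ := hoff ν x'
  obtain ⟨z₃, h₃⟩ := hξ μ ν (pr x')
  have e1 : ξ' ν (e' μ x') - ξ ν (e μ (pr x')) = ((i : ℝ) * s' + ((if ν = μ then s' else 0) - (if ν = μ then s else 0))) + ((z₁ + z₂ - z₃ : ℤ) : ℝ) * K := by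
    rw [h₁, h₂, h₃]; push_cast; ring
  rw [e1]
  refine (abs_cenRep_le_abs_sub hK0 _ (z₁ + z₂ - z₃)).trans ?_
  rw [add_sub_cancel_right]
  have hLr : (1 : ℝ) ≤ L := by exact_mod_cast hL
  have hi' : (i : ℝ) ≤ L := by exact_mod_cast hi
  have hi0 : (0 : ℝ) ≤ i := by positivity
  split_ifs
  · rw [hsL, show (i : ℝ) * s' + (s' - L * s') = ((i : ℝ) + 1 - L) * s' by ring, abs_mul, abs_of_nonneg hs]
    refine mul_le_mul_of_nonneg_right ?_ hs
    rw [abs_le]; constructor <;> linarith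
  · rw [sub_self, add_zero, abs_of_nonneg (by positivity), hsL]
    exact mul_le_mul_of_nonneg_right hi' hs

omit [Fintype J] in
/-- One coordinate, backward: at `e′_μ⁻¹x′` against `e_μ⁻¹(πx′)` the offset is `(i_ν + δ_{νμ}(L − 1))s′ (mod K)`, so the circle distance is `≤ 2s`. [cite: Balaban1985BackgroundPropagators, Thm 3.14 pp.426–427 (shape)] -/
theorem abs_cenRep_shift_symm_pair_le (hK0 : 0 < K) {s s' : ℝ} {L : ℕ} (hL : 1 ≤ L) (hs : 0 ≤ s') (hsL : s = L * s')
    (hξ : ∀ μ ν x, ∃ z : ℤ, ξ ν (e μ x) = ξ ν x + (if ν = μ then s else 0) + z * K) (hξ' : ∀ μ ν x', ∃ z : ℤ, ξ' ν (e' μ x') = ξ' ν x' + (if ν = μ then s' else 0) + z * K)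
    (hoff : ∀ ν x', ∃ i : ℕ, i ≤ L ∧ ∃ z : ℤ, ξ' ν x' = ξ ν (pr x') + i * s' + z * K) (μ ν : J) (x' : X') :
    |cenRep K (ξ' ν ((e' μ).symm x') - ξ ν ((e μ).symm (pr x')))| ≤ 2 * s := by
  obtain ⟨z₁, h₁⟩ := hξ' μ ν ((e' μ).symm x')
  obtain ⟨i, hi, z₂, h₂⟩ := hoff ν x'
  obtain ⟨z₃, h₃⟩ := hξ μ ν ((e μ).symm (pr x'))
  rw [Equiv.apply_symm_apply] at h₁ h₃
  have e1 : ξ' ν ((e' μ).symm x') - ξ ν ((e μ).symm (pr x')) = ((i : ℝ) * s' + ((if ν = μ then s else 0) - (if ν = μ then s' else 0))) + ((z₂ - z₁ + z₃ : ℤ) : ℝ) * K := by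
    have e2 : ξ' ν ((e' μ).symm x') = ξ' ν x' - (if ν = μ then s' else 0) - z₁ * K := by linarith
    have e3 : ξ ν ((e μ).symm (pr x')) = ξ ν (pr x') - (if ν = μ then s else 0) - z₃ * K := by linarith
    rw [e2, e3, h₂]; push_cast; ring
  rw [e1]
  refine (abs_cenRep_le_abs_sub hK0 _ (z₂ - z₁ + z₃)).trans ?_
  rw [add_sub_cancel_right]
  have hLr : (1 : ℝ) ≤ L := by exact_mod_cast hL
  have hi' : (i : ℝ) ≤ L := by exact_mod_cast hi
  have hi0 : (0 : ℝ) ≤ i := by positivity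
  have hsnn : 0 ≤ s := by rw [hsL]; positivity
  split_ifs
  · rw [hsL, show (i : ℝ) * s' + (L * s' - s') = ((i : ℝ) + L - 1) * s' by ring, abs_mul, abs_of_nonneg hs]
    calc ((|(i : ℝ) + L - 1|)) * s' ≤ (2 * L) * s' := by
          refine mul_le_mul_of_nonneg_right ?_ hs
          rw [abs_le]; constructor <;> linarith
      _ = 2 * (L * s') := by ring
  · rw [sub_self, add_zero, abs_of_nonneg (by positivity), hsL]
    calc (i : ℝ) * s' ≤ L * s' := mul_le_mul_of_nonneg_right hi' hs
      _ ≤ 2 * (L * s') := by nlinarith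

/-- ★★ **file 45's `hfit₁` FOR THE SAMPLED BUMP**: `|χ̃′_k(e′_μx′) − χ̃_k(e_μ(πx′))| ≤ π·|J|·s` under FILE 64's `hξ hξ′ hoff`, `s = Ls′`, `L ≥ 1` (FILE II `abs_bcube_sub_bcube_le` at the shifted
pair; `oχ₁ = π|J|s`). [cite: Balaban1985BackgroundPropagators, (3.62)–(3.65) pp.402–403 (shape), Thm 3.14 pp.426–427 (difference template)] -/
theorem abs_bcube_shift_sub_bcube_shift_le (hK0 : 0 < K) {s s' : ℝ} {L : ℕ} (hL : 1 ≤ L) (hs : 0 ≤ s') (hsL : s = L * s')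
    (hξ : ∀ μ ν x, ∃ z : ℤ, ξ ν (e μ x) = ξ ν x + (if ν = μ then s else 0) + z * K) (hξ' : ∀ μ ν x', ∃ z : ℤ, ξ' ν (e' μ x') = ξ' ν x' + (if ν = μ then s' else 0) + z * K)
    (hoff : ∀ ν x', ∃ i : ℕ, i ≤ L ∧ ∃ z : ℤ, ξ' ν x' = ξ ν (pr x') + i * s' + z * K) (k : J → ZMod K) (μ : J) (x' : X') :
    |bcube K ξ' R k (e' μ x') - bcube K ξ R k (e μ (pr x'))| ≤ π * (Fintype.card J * s) := by
  refine (abs_bcube_sub_bcube_le K ξ' R ξ hK0 k _ _).trans (mul_le_mul_of_nonneg_left ?_ Real.pi_pos.le)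
  calc ∑ ν, |cenRep K (ξ' ν (e' μ x') - ξ ν (e μ (pr x')))| ≤ ∑ _ν : J, s :=
        Finset.sum_le_sum fun ν _ => abs_cenRep_shift_pair_le K ξ ξ' pr e e' hK0 hL hs hsL hξ hξ' hoff μ ν x'
    _ = Fintype.card J * s := by rw [Finset.sum_const, Finset.card_univ, nsmul_eq_mul]

/-- ★★ **file 45's `hfit₁b` FOR THE SAMPLED BUMP**: `|χ̃′_k(e′_μ⁻¹x′) − χ̃_k(e_μ⁻¹(πx′))| ≤ 2π·|J|·s` (same data). [cite: Balaban1985BackgroundPropagators, (3.62)–(3.65) pp.402–403 (shape), Thm 3.14 pp.426–427 (difference template)] -/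
theorem abs_bcube_shift_symm_sub_bcube_shift_symm_le (hK0 : 0 < K) {s s' : ℝ} {L : ℕ} (hL : 1 ≤ L) (hs : 0 ≤ s') (hsL : s = L * s')
    (hξ : ∀ μ ν x, ∃ z : ℤ, ξ ν (e μ x) = ξ ν x + (if ν = μ then s else 0) + z * K) (hξ' : ∀ μ ν x', ∃ z : ℤ, ξ' ν (e' μ x') = ξ' ν x' + (if ν = μ then s' else 0) + z * K)
    (hoff : ∀ ν x', ∃ i : ℕ, i ≤ L ∧ ∃ z : ℤ, ξ' ν x' = ξ ν (pr x') + i * s' + z * K) (k : J → ZMod K) (μ : J) (x' : X') :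
    |bcube K ξ' R k ((e' μ).symm x') - bcube K ξ R k ((e μ).symm (pr x'))| ≤ π * (Fintype.card J * (2 * s)) := by
  refine (abs_bcube_sub_bcube_le K ξ' R ξ hK0 k _ _).trans (mul_le_mul_of_nonneg_left ?_ Real.pi_pos.le)
  calc ∑ ν, |cenRep K (ξ' ν ((e' μ).symm x') - ξ ν ((e μ).symm (pr x')))| ≤ ∑ _ν : J, 2 * s :=
        Finset.sum_le_sum fun ν _ => abs_cenRep_shift_symm_pair_le K ξ ξ' pr e e' hK0 hL hs hsL hξ hξ' hoff μ ν x'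
    _ = Fintype.card J * (2 * s) := by rw [Finset.sum_const, Finset.card_univ, nsmul_eq_mul]

end ShiftFit

end Summit.QuantumFields.YangMills.BalabanUVNodes.N15.Gluing

end
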